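import Summits.QuantumFields.BalabanUV.Beta.CombChartJointEndReflTablesAn1S2MWScaled
import Summits.QuantumFields.BalabanUV.Beta.SymVhSliceReflectionAn1

/-!
# `BalabanUV.Beta.CombChartJointEndReflTablesAn1S2MWVScaled` — binder row D1, chart (III″) programme (an2 g56 W-3 l.63100 (D4)∕(D5); leaf-04 g33): **THE κ-TWIN OF THE COMB CHAIN ROOT
# `CombChartJointEndReflTablesAn1S2MWV`** in the ONE-κ currency of RULING R-D1-g56-4 ∕ A-1 l.63035 ∕ W-3 shape (S): literal `JsB12CombShSym hLc N (symTablesAn1S2w 3 Lc (κ·cΛ) κ) (κ·cΛ) cB`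
# (pin `κ·cΛ` in every Λ slot, mixed table `κ • symMixFFAt (ctr 4 Lc) Lc` in every second-order slot, remainders `κ •` the landed ones at the base pin), the Λ-lock
# `cΛ·Lc⁴ = 2` on the BASE pin verbatim where the parent has it, the group weight κ FREE.  MWV: the first-order hR letters (V-r)(H-r) and the second units lock discharged over leaf-04's MWw — κ-free suppliers BY NAME.
# WHAT CHANGES relative to `CombChartJointEndReflTablesAn1S2MWV`: nothing but these substitutions (text transformed by name; the parent's bound fine-bond index `κ` is renamed `κ₁`; see the
# parent and its chart-(II) original for the letter-by-letter account).

HONEST FRAMING (cell contract, verbatim): «discharging `BetaPertH` makes Bałaban's UV stability UNCONDITIONAL — a real constructive-QFT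
result; it is NOT the continuum limit and NOT the Clay problem.»  HONEST DEPENDENCY: continuum YM on T⁴ ⇐ BetaPertH ∧ nine spine estimates (0/9 proved);
BetaPertH ⇐ (D1) ∧ (D4) ∧ CAP+tail; G-an2-4 gates asym, D1 and NE2/3/4.
DERIVED cell leaf ([folklore] wiring BY NAME; β sub-cell, D1 formalisation swarm leaf prover 04 `b2b-balaban-beta-d1-formalise-leaf-04` gen 33, on the row
OWNER an2 g56's programme W-3).  No statement of Bałaban's papers, no `[cite:]`, no `Prop` fact, no `def`; every displayed letter is a BINDER; the VALUE
`κ = Lc¹²∕4` enters nowhere here (the chain is κ-generic).  HONEST: composition by name; root classes 0∕4 discharged; row D1 binders 0∕4; ROOT M‴ p325680 and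
the root of record untouched; NOT D1, NOT `BetaPertH`, NOT continuum, NOT Clay.  Provenance: β sub-cell, unit b2b-balaban-beta-d1-formalise-leaf-04 gen 33,
2026-08-25 (v1); over leaf-04's `CombChartJointEndReflTablesAn1S2MWScaled` (MWw) and an1's `SymVhSliceReflectionAn1` BY NAME; no existing file touched.
-/

noncomputable section

open Finset
open scoped BigOperators
open Literature.Probability.LatticeModels (Torus.proj)
open Literature.MathematicalPhysics.QuantumFieldTheory
open Literature.MathematicalPhysics.QuantumFieldTheory.Balaban1983to89
open Literature.MathematicalPhysics.QuantumFieldTheory.Balaban1983to89.Beta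
open Literature.MathematicalPhysics.QuantumFieldTheory.Balaban1983to89.Beta.VectorTailsLoc (fam kfam)
open Literature.MathematicalPhysics.QuantumFieldTheory.Balaban1983to89.Beta.VectorLegVolumeAdapter (MvE)
open ExpKernelCalculus (MKer BiLoc VertexFamily comp tr tadpole shiftK)
open PolarizationSign (reflSign WardTransversal AxisReflectionCovariant)
open KernelReflection (refK)
open ResolventReflection (bref Φ)
open AffineAveraging (box toSite)
open AveragingContoursRooted (ctr ctrOff ctrOff_mem_box)
open OneStepResolventKernel (Fib LocStencil JetData)
open OneStepKernelFamily (KInvStep colH vertexOfK TbalOf flipK D1Tel D1Rep D1Drift)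
open KernelWard (divV divW)
open StepJetData (mfNeg wilsonA)
open BalabanStepJetsSucc (mmRead wE wVH)
open SecondOrderResponse (dM W2OfK LocStencilFM)
open BalabanCompositeJets (LocStencil₂)
open BalabanStepW2 (M2Of wB2 wV4)
open WilsonBiStencil (wilsonW₂)
open WilsonVertex2Sym (wsym22)
open Summit.QuantumFields.BalabanUV.Beta.TameKernelCalculus
open Summit.QuantumFields.BalabanUV.Beta.ChartConjugation (conjV conjW)
open Summit.QuantumFields.BalabanUV.Beta.ChartConjugationDefectEnd (conjDefect sandwichDefect)
open Summit.QuantumFields.BalabanUV.Beta.AxialDressingRooted (one_le_of_neZero)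
open Summit.QuantumFields.BalabanUV.Beta.SymmetrisedDressingKernel (coDressKSymAt)
open Summit.QuantumFields.BalabanUV.Beta.AveragingWardRootedStencils (legInd)
open Summit.QuantumFields.BalabanUV.Beta.SymmetrisedStepJets (SymTables)
open Summit.QuantumFields.BalabanUV.Beta.CombChartStepJets (GcombSh ScombOf SpureCombOf JsB12CombSh0)
open Summit.QuantumFields.BalabanUV.Beta.CombChartJointEnd (JsB12CombShSym)
open Summit.QuantumFields.BalabanUV.Beta.SpineRooted (M1Of SpureRecOf T2RecOf WrecOf)
open Summit.QuantumFields.BalabanUV.Beta.WardLocusRecursive (SrecOf)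
open Summit.QuantumFields.BalabanUV.Beta.WardLocusCubic (mmSym)
open Summit.QuantumFields.BalabanUV.Beta.SymShiftedSpread (bhKStepSh)
open Summit.QuantumFields.BalabanUV.Beta.BorderedHessian (sgnK bhK stepScale diagK)
open Summit.QuantumFields.BalabanUV.Beta.E3ContactGenerator (ctGenM)
open Summit.QuantumFields.BalabanUV.Beta.DshAn1 (Dsh)
open Summit.QuantumFields.BalabanUV.Beta.SymAveragingHessianCounts (symVhSAt symHessFFAt)
open Summit.QuantumFields.BalabanUV.Beta.SymAveragingMixedJetTables (symMixFFAt)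
open Summit.QuantumFields.BalabanUV.Beta.SymSecondOrderTablesAn1 (symVh₂SAn1)
open Summit.QuantumFields.BalabanUV.Beta.SymTablesAn1S2Weighted (symTablesAn1S2w)
open Summit.QuantumFields.BalabanUV.Beta.SymMixedReflectionLetterAn1 (symRMrAn1)

open Summit.QuantumFields.BalabanUV.Beta.CombChartJointEndReflTablesAn1S2MWScaled (d1Drift_JsB12CombShSym_an1TablesS2w_of_bordReflLetters_D1Tel_D1Rep_of_locks)
open Summit.QuantumFields.BalabanUV.Beta.SymVhSliceReflectionAn1 (hVfm_sym hVmf_sym hVmm_sym)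
open Summit.QuantumFields.BalabanUV.Beta.SymRootedKernelReflection (hHr_sym)

namespace Summit.QuantumFields.BalabanUV.Beta.CombChartJointEndReflTablesAn1S2MWVScaled

variable {Lc : ℕ} [NeZero Lc]

/-- **ROW D1 — THE LITERAL ROOT AT THE WEIGHTED RECORD `symTablesAn1S2w 3 Lc (κ·cΛ) κ` WITH THE hW CLASS AND THE FIRST-ORDER hR LETTERS DISCHARGED**, every
group weight `κ` — the κ-twin of `CombChartJointEndReflTablesAn1S2MWV.d1Drift_…_of_secondOrderReflLetters_…_of_locks`: MWw (`CombChartJointEndReflTablesAn1S2MWScaled`)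
with the first-order reflection letters (V-r)(H-r) of an1's concrete sym tables supplied BY NAME (`SymVhSliceReflectionAn1.hVfm_sym ∕ hVmf_sym ∕ hVmm_sym ∕ hHr_sym`
— FIRST-ORDER, κ-free) and the second units lock `hlock2` by `ring`.  At `κ = 1` this is the parent's statement.  HONEST: composition by name; NOT D1. -/
theorem d1Drift_JsB12CombShSym_an1TablesS2w_of_secondOrderReflLetters_D1Tel_D1Rep_of_locks (hLc : Odd Lc) (hL2 : 2 ≤ Lc) {N : ℕ} (hN : 2 ≤ N) (cΛ κ cB : ℝ)
    -- the two unit locks of an1's TABLE-FIT tier 2 (Λ-lock on the BASE pin `cΛ`, VERBATIM; B-lock); the group weight `κ` is FREE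
    (hΛ : cΛ * (Lc : ℝ) ^ 4 = 2) (hcB : cB = -((Lc : ℝ) ^ 12 / 4))
    -- the first-order contact coefficient, displayed
    (γ : ℕ → ℝ) (hγ : ∀ j, γ j = -((Lc : ℝ) ^ 8 / 2) * wVH 3 Lc j / (stepScale 3 Lc j * (Lc : ℝ) ^ 4))
    -- hR, SECOND ORDER, TABLE-LEVEL: the second-order TABLE reflection letters
    -- (level-0 letter, mixed letter ∀ j, border letter ∀ j+1), the mechanical split identities + localisations, the remainder recursion (with the four
    -- inner sandwich-defect words of `SecondOrderInverseShapeDefect.K3_sharp_defect`) — the hypotheses of `SpineRooted.WrecOf_brefC_of_tableLetters_comb`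
    (h2 : ℕ → Fin 4 → Fin 4 → (Fin 4 → ℤ) → Fin 4 → (Fin 4 → ℤ) → (Fin 4 → ℤ) → Fib 3 → ℝ)
    (R2 : ℕ → Fin 4 → Fin 4 → (Fin 4 → ℤ) → Fin 4 → (Fin 4 → ℤ) → MKer 4 (Fib 3))
    (h0 : ∀ (α κ₁ : Fin 4) (u : Fin 4 → ℤ) (κ₁' : Fin 4) (u' : Fin 4 → ℤ),
      T2RecOf 3 Lc (GcombSh Lc) (SpureRecOf 3 Lc (symVhSAt (ctr 4 Lc) 3 Lc rfl) (symHessFFAt (ctr 4 Lc) Lc) (GcombSh Lc) ((Lc : ℝ) ^ 4) (-((Lc : ℝ) ^ 8 / 2)) (κ * cΛ)) (M1Of 3 Lc (symHessFFAt (ctr 4 Lc) Lc) (κ * cΛ)) ((Lc : ℝ) ^ 8) cB ((8 * (N : ℝ) ^ 2)⁻¹ • wsym22 N) (symVh₂SAn1 3 Lc) (κ • symMixFFAt (ctr 4 Lc) Lc) 0 κ₁ (bref α κ₁ u) κ₁' (bref α κ₁' u') =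
        (reflSign α κ₁ * reflSign α κ₁') • refK (Φ Lc α)
          (T2RecOf 3 Lc (GcombSh Lc) (SpureRecOf 3 Lc (symVhSAt (ctr 4 Lc) 3 Lc rfl) (symHessFFAt (ctr 4 Lc) Lc) (GcombSh Lc) ((Lc : ℝ) ^ 4) (-((Lc : ℝ) ^ 8 / 2)) (κ * cΛ)) (M1Of 3 Lc (symHessFFAt (ctr 4 Lc) Lc) (κ * cΛ)) ((Lc : ℝ) ^ 8) cB ((8 * (N : ℝ) ^ 2)⁻¹ • wsym22 N) (symVh₂SAn1 3 Lc) (κ • symMixFFAt (ctr 4 Lc) Lc) 0 κ₁ u κ₁' u' +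
            conjW (bhKStepSh 3 Lc (Dsh Lc) 0) (SpureRecOf 3 Lc (symVhSAt (ctr 4 Lc) 3 Lc rfl) (symHessFFAt (ctr 4 Lc) Lc) (GcombSh Lc) ((Lc : ℝ) ^ 4) (-((Lc : ℝ) ^ 8 / 2)) (κ * cΛ) 0 κ₁ u) (SpureRecOf 3 Lc (symVhSAt (ctr 4 Lc) 3 Lc rfl) (symHessFFAt (ctr 4 Lc) Lc) (GcombSh Lc) ((Lc : ℝ) ^ 4) (-((Lc : ℝ) ^ 8 / 2)) (κ * cΛ) 0 κ₁' u')
              (diagK fun p c => γ 0 * ctGenM 3 (bhK Lc + Dsh Lc) α Lc κ₁ u p c) (diagK fun p c => γ 0 * ctGenM 3 (bhK Lc + Dsh Lc) α Lc κ₁' u' p c) (diagK (h2 0 α κ₁ u κ₁' u')) +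
            R2 0 α κ₁ u κ₁' u'))
    (X2s : ℕ → Fin 4 → Fin 4 → (Fin 4 → ℤ) → Fin 4 → (Fin 4 → ℤ) → (Fin 4 → ℤ) → Fib 3 → ℝ)
    (Δ : ℕ → Fin 4 → Fin 4 → (Fin 4 → ℤ) → Fin 4 → (Fin 4 → ℤ) → MKer 4 (Fib 3))
    (hsplit : ∀ (j : ℕ) (α μ : Fin 4) (y : Fin 4 → ℤ) (ν : Fin 4) (y' : Fin 4 → ℤ),
      W2OfK (GcombSh (d := 3) Lc j) Lc
          (fun κ₁ u => SpureRecOf 3 Lc (symVhSAt (ctr 4 Lc) 3 Lc rfl) (symHessFFAt (ctr 4 Lc) Lc) (GcombSh Lc) ((Lc : ℝ) ^ 4) (-((Lc : ℝ) ^ 8 / 2)) (κ * cΛ) j κ₁ u + conjV (bhKStepSh 3 Lc (Dsh Lc) j) (diagK fun p c => γ j * ctGenM 3 (bhK Lc + Dsh Lc) α Lc κ₁ u p c))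
          (M1Of 3 Lc (symHessFFAt (ctr 4 Lc) Lc) (κ * cΛ) j)
          (fun κ₁ u κ₁' u' => T2RecOf 3 Lc (GcombSh Lc) (SpureRecOf 3 Lc (symVhSAt (ctr 4 Lc) 3 Lc rfl) (symHessFFAt (ctr 4 Lc) Lc) (GcombSh Lc) ((Lc : ℝ) ^ 4) (-((Lc : ℝ) ^ 8 / 2)) (κ * cΛ)) (M1Of 3 Lc (symHessFFAt (ctr 4 Lc) Lc) (κ * cΛ)) ((Lc : ℝ) ^ 8) cB ((8 * (N : ℝ) ^ 2)⁻¹ • wsym22 N) (symVh₂SAn1 3 Lc) (κ • symMixFFAt (ctr 4 Lc) Lc) j κ₁ u κ₁' u' +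
            conjW (bhKStepSh 3 Lc (Dsh Lc) j) (SpureRecOf 3 Lc (symVhSAt (ctr 4 Lc) 3 Lc rfl) (symHessFFAt (ctr 4 Lc) Lc) (GcombSh Lc) ((Lc : ℝ) ^ 4) (-((Lc : ℝ) ^ 8 / 2)) (κ * cΛ) j κ₁ u) (SpureRecOf 3 Lc (symVhSAt (ctr 4 Lc) 3 Lc rfl) (symHessFFAt (ctr 4 Lc) Lc) (GcombSh Lc) ((Lc : ℝ) ^ 4) (-((Lc : ℝ) ^ 8 / 2)) (κ * cΛ) j κ₁' u')
              (diagK fun p c => γ j * ctGenM 3 (bhK Lc + Dsh Lc) α Lc κ₁ u p c) (diagK fun p c => γ j * ctGenM 3 (bhK Lc + Dsh Lc) α Lc κ₁' u' p c) (diagK (h2 j α κ₁ u κ₁' u')) +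
            R2 j α κ₁ u κ₁' u')
          (fun κ₁ u ρ w => M2Of 3 Lc (κ • symMixFFAt (ctr 4 Lc) Lc) j κ₁ u ρ w + conjV (M1Of 3 Lc (symHessFFAt (ctr 4 Lc) Lc) (κ * cΛ) j ρ w) (diagK fun p c => γ j * ctGenM 3 (bhK Lc + Dsh Lc) α Lc κ₁ u p c) + κ • symRMrAn1 Lc cΛ γ j α κ₁ u ρ w)
          μ y ν y' =
        W2OfK (GcombSh (d := 3) Lc j) Lc (SpureRecOf 3 Lc (symVhSAt (ctr 4 Lc) 3 Lc rfl) (symHessFFAt (ctr 4 Lc) Lc) (GcombSh Lc) ((Lc : ℝ) ^ 4) (-((Lc : ℝ) ^ 8 / 2)) (κ * cΛ) j) (M1Of 3 Lc (symHessFFAt (ctr 4 Lc) Lc) (κ * cΛ) j)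
            (T2RecOf 3 Lc (GcombSh Lc) (SpureRecOf 3 Lc (symVhSAt (ctr 4 Lc) 3 Lc rfl) (symHessFFAt (ctr 4 Lc) Lc) (GcombSh Lc) ((Lc : ℝ) ^ 4) (-((Lc : ℝ) ^ 8 / 2)) (κ * cΛ)) (M1Of 3 Lc (symHessFFAt (ctr 4 Lc) Lc) (κ * cΛ)) ((Lc : ℝ) ^ 8) cB ((8 * (N : ℝ) ^ 2)⁻¹ • wsym22 N) (symVh₂SAn1 3 Lc) (κ • symMixFFAt (ctr 4 Lc) Lc) j)
            (M2Of 3 Lc (κ • symMixFFAt (ctr 4 Lc) Lc) j) μ y ν y' +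
          conjW (bhKStepSh 3 Lc (Dsh Lc) j)
            (dM (GcombSh Lc j) Lc (SpureRecOf 3 Lc (symVhSAt (ctr 4 Lc) 3 Lc rfl) (symHessFFAt (ctr 4 Lc) Lc) (GcombSh Lc) ((Lc : ℝ) ^ 4) (-((Lc : ℝ) ^ 8 / 2)) (κ * cΛ) j) (M1Of 3 Lc (symHessFFAt (ctr 4 Lc) Lc) (κ * cΛ) j) μ y)
            (dM (GcombSh Lc j) Lc (SpureRecOf 3 Lc (symVhSAt (ctr 4 Lc) 3 Lc rfl) (symHessFFAt (ctr 4 Lc) Lc) (GcombSh Lc) ((Lc : ℝ) ^ 4) (-((Lc : ℝ) ^ 8 / 2)) (κ * cΛ) j) (M1Of 3 Lc (symHessFFAt (ctr 4 Lc) Lc) (κ * cΛ) j) ν y')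
            (diagK fun p c => ∑ κ₁, ∑' u, colH (GcombSh Lc j) Lc μ y κ₁ u * (γ j * ctGenM 3 (bhK Lc + Dsh Lc) α Lc κ₁ u p c))
            (diagK fun p c => ∑ κ₁, ∑' u, colH (GcombSh Lc j) Lc ν y' κ₁ u * (γ j * ctGenM 3 (bhK Lc + Dsh Lc) α Lc κ₁ u p c))
            (diagK (X2s j α μ y ν y')) +
          Δ j α μ y ν y')
    (hDg : ∀ (j : ℕ) (α ν : Fin 4) (y' : Fin 4 → ℤ),
      Loc (dM (GcombSh (d := 3) Lc j) Lc (fun κ₁ u => SpureRecOf 3 Lc (symVhSAt (ctr 4 Lc) 3 Lc rfl) (symHessFFAt (ctr 4 Lc) Lc) (GcombSh Lc) ((Lc : ℝ) ^ 4) (-((Lc : ℝ) ^ 8 / 2)) (κ * cΛ) j κ₁ u + conjV (bhKStepSh 3 Lc (Dsh Lc) j) (diagK fun p c => γ j * ctGenM 3 (bhK Lc + Dsh Lc) α Lc κ₁ u p c)) (M1Of 3 Lc (symHessFFAt (ctr 4 Lc) Lc) (κ * cΛ) j) ν y'))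
    (hX2L : ∀ j α μ y ν y', Loc (diagK (X2s j α μ y ν y'))) (hΔL : ∀ j α μ y ν y', Loc (Δ j α μ y ν y'))
    (RBr : ℕ → Fin 4 → Fin 4 → (Fin 4 → ℤ) → Fin 4 → (Fin 4 → ℤ) → MKer 4 (Fib 3))
    (hRBrff : ∀ j α κ₁ u κ₁' u' (x z : Fin 4 → ℤ) (β β' : Fin 4), RBr j α κ₁ u κ₁' u' x z (Sum.inl β) (Sum.inl β') = 0)
    (hBfm : ∀ (j : ℕ) (α : Fin 4) κ₁ u κ₁' u' (x z : Fin 4 → ℤ) (β m : Fin 4),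
      ((cB * wB2 3 Lc (j + 1)) • symVh₂SAn1 3 Lc κ₁ (bref α κ₁ u) κ₁' (bref α κ₁' u')) x z (Sum.inl β) (Sum.inr m) =
        ((reflSign α κ₁ * reflSign α κ₁') • refK (Φ Lc α) ((cB * wB2 3 Lc (j + 1)) • symVh₂SAn1 3 Lc κ₁ u κ₁' u' +
          conjW (bhKStepSh 3 Lc (Dsh Lc) (j + 1)) (SpureRecOf 3 Lc (symVhSAt (ctr 4 Lc) 3 Lc rfl) (symHessFFAt (ctr 4 Lc) Lc) (GcombSh Lc) ((Lc : ℝ) ^ 4) (-((Lc : ℝ) ^ 8 / 2)) (κ * cΛ) (j + 1) κ₁ u) (SpureRecOf 3 Lc (symVhSAt (ctr 4 Lc) 3 Lc rfl) (symHessFFAt (ctr 4 Lc) Lc) (GcombSh Lc) ((Lc : ℝ) ^ 4) (-((Lc : ℝ) ^ 8 / 2)) (κ * cΛ) (j + 1) κ₁' u')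
            (diagK fun p c => γ (j + 1) * ctGenM 3 (bhK Lc + Dsh Lc) α Lc κ₁ u p c) (diagK fun p c => γ (j + 1) * ctGenM 3 (bhK Lc + Dsh Lc) α Lc κ₁' u' p c)
            (diagK (h2 (j + 1) α κ₁ u κ₁' u')) + RBr (j + 1) α κ₁ u κ₁' u')) x z (Sum.inl β) (Sum.inr m))
    (hBmf : ∀ (j : ℕ) (α : Fin 4) κ₁ u κ₁' u' (x z : Fin 4 → ℤ) (m β : Fin 4),
      ((cB * wB2 3 Lc (j + 1)) • symVh₂SAn1 3 Lc κ₁ (bref α κ₁ u) κ₁' (bref α κ₁' u')) x z (Sum.inr m) (Sum.inl β) =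
        ((reflSign α κ₁ * reflSign α κ₁') • refK (Φ Lc α) ((cB * wB2 3 Lc (j + 1)) • symVh₂SAn1 3 Lc κ₁ u κ₁' u' +
          conjW (bhKStepSh 3 Lc (Dsh Lc) (j + 1)) (SpureRecOf 3 Lc (symVhSAt (ctr 4 Lc) 3 Lc rfl) (symHessFFAt (ctr 4 Lc) Lc) (GcombSh Lc) ((Lc : ℝ) ^ 4) (-((Lc : ℝ) ^ 8 / 2)) (κ * cΛ) (j + 1) κ₁ u) (SpureRecOf 3 Lc (symVhSAt (ctr 4 Lc) 3 Lc rfl) (symHessFFAt (ctr 4 Lc) Lc) (GcombSh Lc) ((Lc : ℝ) ^ 4) (-((Lc : ℝ) ^ 8 / 2)) (κ * cΛ) (j + 1) κ₁' u')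
            (diagK fun p c => γ (j + 1) * ctGenM 3 (bhK Lc + Dsh Lc) α Lc κ₁ u p c) (diagK fun p c => γ (j + 1) * ctGenM 3 (bhK Lc + Dsh Lc) α Lc κ₁' u' p c)
            (diagK (h2 (j + 1) α κ₁ u κ₁' u')) + RBr (j + 1) α κ₁ u κ₁' u')) x z (Sum.inr m) (Sum.inl β))
    (hBmm : ∀ (j : ℕ) (α : Fin 4) κ₁ u κ₁' u' (x z : Fin 4 → ℤ) (m m' : Fin 4),
      ((cB * wB2 3 Lc (j + 1)) • symVh₂SAn1 3 Lc κ₁ (bref α κ₁ u) κ₁' (bref α κ₁' u')) x z (Sum.inr m) (Sum.inr m') =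
        ((reflSign α κ₁ * reflSign α κ₁') • refK (Φ Lc α) ((cB * wB2 3 Lc (j + 1)) • symVh₂SAn1 3 Lc κ₁ u κ₁' u' +
          conjW (bhKStepSh 3 Lc (Dsh Lc) (j + 1)) (SpureRecOf 3 Lc (symVhSAt (ctr 4 Lc) 3 Lc rfl) (symHessFFAt (ctr 4 Lc) Lc) (GcombSh Lc) ((Lc : ℝ) ^ 4) (-((Lc : ℝ) ^ 8 / 2)) (κ * cΛ) (j + 1) κ₁ u) (SpureRecOf 3 Lc (symVhSAt (ctr 4 Lc) 3 Lc rfl) (symHessFFAt (ctr 4 Lc) Lc) (GcombSh Lc) ((Lc : ℝ) ^ 4) (-((Lc : ℝ) ^ 8 / 2)) (κ * cΛ) (j + 1) κ₁' u')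
            (diagK fun p c => γ (j + 1) * ctGenM 3 (bhK Lc + Dsh Lc) α Lc κ₁ u p c) (diagK fun p c => γ (j + 1) * ctGenM 3 (bhK Lc + Dsh Lc) α Lc κ₁' u' p c)
            (diagK (h2 (j + 1) α κ₁ u κ₁' u')) + RBr (j + 1) α κ₁ u κ₁' u')) x z (Sum.inr m) (Sum.inr m'))
    (hR2succ : ∀ (j : ℕ) (α κ₁ : Fin 4) (u : Fin 4 → ℤ) (κ₁' : Fin 4) (u' : Fin 4 → ℤ),
      R2 (j + 1) α κ₁ u κ₁' u' =
          (-((((Lc : ℝ) ^ 8) * wV4 3 Lc (j + 1)) • mmRead Lc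
              (comp (comp (GcombSh Lc j) (((1 / 2 : ℝ) • conjV (bhKStepSh 3 Lc (Dsh Lc) j) (diagK fun p a => X2s j α κ₁' u' κ₁ u p a - X2s j α κ₁ u κ₁' u' p a) +
                (1 / 2 : ℝ) • (Δ j α κ₁ u κ₁' u' + Δ j α κ₁' u' κ₁ u)))) (GcombSh Lc j) -
                (comp (sandwichDefect (GcombSh Lc j) (bhKStepSh 3 Lc (Dsh Lc) j)
                      (diagK fun p c => ∑ ι, ∑' v, colH (GcombSh Lc j) Lc κ₁ u ι v * (γ j * ctGenM 3 (bhK Lc + Dsh Lc) α Lc ι v p c)))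
                    (comp (dM (GcombSh Lc j) Lc (SpureRecOf 3 Lc (symVhSAt (ctr 4 Lc) 3 Lc rfl) (symHessFFAt (ctr 4 Lc) Lc) (GcombSh Lc) ((Lc : ℝ) ^ 4) (-((Lc : ℝ) ^ 8 / 2)) (κ * cΛ) j) (M1Of 3 Lc (symHessFFAt (ctr 4 Lc) Lc) (κ * cΛ) j) κ₁' u') (GcombSh Lc j) -
                      diagK fun p c => ∑ ι, ∑' v, colH (GcombSh Lc j) Lc κ₁' u' ι v * (γ j * ctGenM 3 (bhK Lc + Dsh Lc) α Lc ι v p c))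
                  + comp (comp (GcombSh Lc j) (dM (GcombSh Lc j) Lc (SpureRecOf 3 Lc (symVhSAt (ctr 4 Lc) 3 Lc rfl) (symHessFFAt (ctr 4 Lc) Lc) (GcombSh Lc) ((Lc : ℝ) ^ 4) (-((Lc : ℝ) ^ 8 / 2)) (κ * cΛ) j) (M1Of 3 Lc (symHessFFAt (ctr 4 Lc) Lc) (κ * cΛ) j) κ₁ u +
                      conjV (bhKStepSh 3 Lc (Dsh Lc) j) (diagK fun p c => ∑ ι, ∑' v, colH (GcombSh Lc j) Lc κ₁ u ι v * (γ j * ctGenM 3 (bhK Lc + Dsh Lc) α Lc ι v p c))))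
                    (sandwichDefect (GcombSh Lc j) (bhKStepSh 3 Lc (Dsh Lc) j)
                      (diagK fun p c => ∑ ι, ∑' v, colH (GcombSh Lc j) Lc κ₁' u' ι v * (γ j * ctGenM 3 (bhK Lc + Dsh Lc) α Lc ι v p c)))
                  + comp (sandwichDefect (GcombSh Lc j) (bhKStepSh 3 Lc (Dsh Lc) j)
                      (diagK fun p c => ∑ ι, ∑' v, colH (GcombSh Lc j) Lc κ₁' u' ι v * (γ j * ctGenM 3 (bhK Lc + Dsh Lc) α Lc ι v p c)))
                    (comp (dM (GcombSh Lc j) Lc (SpureRecOf 3 Lc (symVhSAt (ctr 4 Lc) 3 Lc rfl) (symHessFFAt (ctr 4 Lc) Lc) (GcombSh Lc) ((Lc : ℝ) ^ 4) (-((Lc : ℝ) ^ 8 / 2)) (κ * cΛ) j) (M1Of 3 Lc (symHessFFAt (ctr 4 Lc) Lc) (κ * cΛ) j) κ₁ u) (GcombSh Lc j) -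
                      diagK fun p c => ∑ ι, ∑' v, colH (GcombSh Lc j) Lc κ₁ u ι v * (γ j * ctGenM 3 (bhK Lc + Dsh Lc) α Lc ι v p c))
                  + comp (comp (GcombSh Lc j) (dM (GcombSh Lc j) Lc (SpureRecOf 3 Lc (symVhSAt (ctr 4 Lc) 3 Lc rfl) (symHessFFAt (ctr 4 Lc) Lc) (GcombSh Lc) ((Lc : ℝ) ^ 4) (-((Lc : ℝ) ^ 8 / 2)) (κ * cΛ) j) (M1Of 3 Lc (symHessFFAt (ctr 4 Lc) Lc) (κ * cΛ) j) κ₁' u' +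
                      conjV (bhKStepSh 3 Lc (Dsh Lc) j) (diagK fun p c => ∑ ι, ∑' v, colH (GcombSh Lc j) Lc κ₁' u' ι v * (γ j * ctGenM 3 (bhK Lc + Dsh Lc) α Lc ι v p c))))
                    (sandwichDefect (GcombSh Lc j) (bhKStepSh 3 Lc (Dsh Lc) j)
                      (diagK fun p c => ∑ ι, ∑' v, colH (GcombSh Lc j) Lc κ₁ u ι v * (γ j * ctGenM 3 (bhK Lc + Dsh Lc) α Lc ι v p c)))))) +
            RBr (j + 1) α κ₁ u κ₁' u' +
            conjV (mmRead Lc (GcombSh (d := 3) Lc j))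
              (diagK fun p c => ((Lc : ℝ) ^ 8) * wV4 3 Lc (j + 1) * mmSym Lc (X2s j α κ₁ u κ₁' u') p c - wVH 3 Lc (j + 1) * h2 (j + 1) α κ₁ u κ₁' u' p c)))
    -- the cancellation of the chart-(II) defect against the W-REMAINDER `Rm_j` (the compensator is now IDENTIFIED: `Wc := Rm`, `X₂ := diagK X2s`) — the (N8) object
    (hRm0 : ∀ (j : ℕ) (α μ : Fin 4) (y : Fin 4 → ℤ) (ν : Fin 4) (y' : Fin 4 → ℤ),
      tadpole (GcombSh Lc j)
        ((1 / 2 : ℝ) • conjV (bhKStepSh 3 Lc (Dsh Lc) j) (diagK fun p a => X2s j α ν y' μ y p a - X2s j α μ y ν y' p a) +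
          (1 / 2 : ℝ) • (Δ j α μ y ν y' + Δ j α ν y' μ y)) = 0)
    -- the route theorem's own binders, verbatim
    (a : ℝ) (ha : 0 < a)
    (h12 : B5.Prop12Printed (fam (fun i : ℕ+ × ℕ => ((i.1 : ℕ+) : ℕ)) (fun i => i.1.pos) MvE a ha))
    (h126 : B5.Kernel126_127Printed (kfam (fun i : ℕ+ × ℕ => ((i.1 : ℕ+) : ℕ)) MvE))
    {L : Type*} {SL : Finset L} (hSL : SL.Nonempty) (k : L → Fin 4) {μ ν : Fin 4} (hμν : μ ≠ ν) {Nc : ℝ} (hNc : Nc ≠ 0)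
    (Jc : ∀ m : ℕ, JetData 3 (Lc ^ m))
    (htel : D1Tel Lc (JsB12CombShSym hLc N (symTablesAn1S2w 3 Lc (κ * cΛ) κ) (κ * cΛ) cB) Jc)
    {cc : ℝ} {Mw' : ℕ → ℕ} (hc : 1 ≤ cc) (hMwin : ∀ L : ℕ, 2 ≤ L → 1 ≤ Mw' L ∧ (L : ℝ) ≤ cc * Mw' L) (hML : ∀ L : ℕ, 2 ≤ L → Mw' L ≤ L)
    (hrep : D1Rep Lc Jc Nc μ ν a SL k) :
    D1Drift Lc (JsB12CombShSym hLc N (symTablesAn1S2w 3 Lc (κ * cΛ) κ) (κ * cΛ) cB) Nc μ ν := by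
  have hlock2 : ∀ j : ℕ, ((Lc : ℝ) ^ 8) * wV4 3 Lc (j + 1) * wVH 3 Lc (j + 1) = ((Lc : ℝ) ^ 4 * wE 3 Lc (j + 1)) ^ 2 := fun j => by
    simp only [BalabanStepW2.wV4, BalabanStepJetsSucc.wVH, BalabanStepJetsSucc.wE]
    ring
  exact d1Drift_JsB12CombShSym_an1TablesS2w_of_bordReflLetters_D1Tel_D1Rep_of_locks hLc hL2 hN cΛ κ cB hΛ hcB (hVfm_sym hLc) (hVmf_sym hLc) (hVmm_sym hLc)
    (hHr_sym hLc) γ hγ hlock2 h2 R2 h0 X2s Δ hsplit hDg hX2L hΔL RBr hRBrff hBfm hBmf hBmm hR2succ hRm0 a ha h12 h126 hSL k hμν hNc Jc htel hc hMwin hML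
    hrep

end Summit.QuantumFields.BalabanUV.Beta.CombChartJointEndReflTablesAn1S2MWVScaled

end
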